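import Summits.HodgeConjecture.CorCM.HypLiu418.A3Liu418EpsRigidAtFace
import Summits.HodgeConjecture.CorCM.HypLiu418.A3Liu418LocalTypeGaloisTwist
import Summits.HodgeConjecture.CorCM.HypLiu418.A3Liu418CyclotomicUnitIsLocalNormOdd
import Summits.HodgeConjecture.CorCM.HypLiu418.A3Liu418CyclotomicUnitIsLocalNormDyadic
import Summits.HodgeConjecture.HodgeConjecture.Theorems.A3Liu418PrescribedLocalSquareClass
import HarnessLib

/-!
# Line `a3-liu418`, row III-11: ε-rigidity under Galois twist at `V`'s own face — the binder facts FED BY NAME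

Summits side, binder subdirectory `CorCM/HypLiu418/` (cell `hodgecm-mathlib`, fan A, rung A-III; crux item
stmt-HodgeConjecture-24832, `Summit.HodgeConjecture.HodgeConjecture.Theses.HCCMUnconditional.HLiu418`; row III-11 of the
inventory = [Liu2021, Thm. 4.18 (3)] «the local theta dichotomy sign `ε` is fixed under `Aut(ℂ/M_μ)`»).  THEOREMS ONLY (proof
lane), no definition, no named fact of its own.

`A3Liu418EpsRigidAtFace.lean` (A-p19) proved the face Prop `EpsRigidAtFace` from the four binder facts of
`A3Liu418EpsRigidFaceTypes.lean` — `epsRigidAtFace_of_localTwist (hT) (hN) (hN₂) (hS)`.  Three of the four are now tree theorems: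

* III-11a `LocalTypeGaloisTwist` — `localTypeGaloisTwist_holds` (`A3Liu418LocalTypeGaloisTwist.lean`, B-p08, over the local
  Galois transport of the `μ`-normalised splittings, B-p02/B-p03/B-p13/B-p14);
* III-11b `CyclotomicUnitIsLocalNormOdd` — `HypLiu418.cyclotomicUnitIsLocalNormOdd_holds` (A-p11);
* III-11d `PrescribedLocalSquareClass` — `prescribedLocalSquareClass_holds` (A-p12).

Feeding them by name leaves row III-11 resting on the single dyadic binder III-11c `CyclotomicUnitIsLocalNormDyadic`
(`epsRigidAtFace_of_cyclotomicUnitIsLocalNormDyadic`), itself reduced by A-p11 to the projection formula for Hilbert symbols at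
the dyadic completions (`HypLiu418.cyclotomicUnitIsLocalNormDyadic_of_localNormCompat`), which A-p13's
`Literature/NumberTheory/QuadraticForms/HilbertSymbolNormCompatAtTwoCompletion.lean` proves; the fourth is therefore also a tree
theorem, `HypLiu418.cyclotomicUnitIsLocalNormDyadic_holds` (A-p11), and **`epsRigidAtFace_holds : EpsRigidAtFace`** closes row
III-11 outright — the one name read by the floor editions (`Theorems/HCCMUnconditionalOfFloor.lean`, B-p10), the line skeleton
`Cruxes/HLiu418/Lines/a3_liu418.lean` (A-plan2) and `HypLiu418.HLiu418_of_facts` (A-p18).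

HC_CM is proved only modulo the 7 printed citations (`hDel`, `h21`, `hLiu418`, `h411`, `h413`, `hD3`, `hD1''`) until rung 0
closes; this file discharges none of them.

## References
* [Liu2021] Y. Liu, *Fourier–Jacobi cycles and arithmetic relative trace formula*, Camb. J. Math. 9 (2021) = arXiv:2102.11518,
  Thm. 4.18 (3) with proof l. 2272–2289.
* [BushnellHenniart2006] C. J. Bushnell, G. Henniart, *The local Langlands conjecture for GL(2)*, Grundlehren 335, §41.2 (2).
-/

set_option autoImplicit false

noncomputable section

namespace Summit.HodgeConjecture.CorCM.Lines.A3Liu418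

/-- **Row III-11 from the dyadic binder alone**: `CyclotomicUnitIsLocalNormDyadic → EpsRigidAtFace`, the other three binder facts
of `epsRigidAtFace_of_localTwist` (III-11a `localTypeGaloisTwist_holds`, III-11b `HypLiu418.cyclotomicUnitIsLocalNormOdd_holds`,
III-11d `prescribedLocalSquareClass_holds`) fed by name.
[cite: Liu2021, Thm. 4.18 (3) with proof l. 2272–2289] [cite: BushnellHenniart2006, §41.2 (2)] -/
theorem epsRigidAtFace_of_cyclotomicUnitIsLocalNormDyadic (hN₂ : CyclotomicUnitIsLocalNormDyadic) : EpsRigidAtFace :=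
  epsRigidAtFace_of_localTwist localTypeGaloisTwist_holds
    Summit.HodgeConjecture.CorCM.HypLiu418.cyclotomicUnitIsLocalNormOdd_holds hN₂ prescribedLocalSquareClass_holds

/-- **★ Row III-11 OUTRIGHT — [Liu2021, Thm. 4.18 (3)] ε-rigidity under Galois twist at `V`'s own relabelled one-object rest,
`EpsRigidAtFace`, with NO hypothesis**: the dyadic binder III-11c fed by A-p11's `HypLiu418.cyclotomicUnitIsLocalNormDyadic_holds`
(over A-p13's projection formula for Hilbert symbols at the dyadic completions of number fields,
`Literature.NumberTheory.QuadraticForms.hilbertSymbol_normCompat_adicCompletion_two`).  Unfolds (δ) to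
`epsRigidAtFace_of_localTwist localTypeGaloisTwist_holds HypLiu418.cyclotomicUnitIsLocalNormOdd_holds
HypLiu418.cyclotomicUnitIsLocalNormDyadic_holds prescribedLocalSquareClass_holds`.
[cite: Liu2021, Thm. 4.18 (3) with proof l. 2272–2289] [cite: BushnellHenniart2006, §41.2 (2)] -/
theorem epsRigidAtFace_holds : EpsRigidAtFace :=
  epsRigidAtFace_of_cyclotomicUnitIsLocalNormDyadic
    Summit.HodgeConjecture.CorCM.HypLiu418.cyclotomicUnitIsLocalNormDyadic_holds

end Summit.HodgeConjecture.CorCM.Lines.A3Liu418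

end
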